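import Summits.ValiantsHypothesis.ValiantsHypothesis.Theses.SOSTau
import Summits.ValiantsHypothesis.ValiantsHypothesis.Theorems.SOSTauSOSTauStubGaussPair
import Summits.ValiantsHypothesis.ValiantsHypothesis.Theorems.SOSTauSOSTauStubRobustOfGaussPair
import Summits.ValiantsHypothesis.ValiantsHypothesis.Theorems.SOSTauSOSTauStubPosOfRobustShallow
import Summits.ValiantsHypothesis.ValiantsHypothesis.Theorems.SOSTauSOSTauStubCruxOfPos
import Summits.ValiantsHypothesis.ValiantsHypothesis.Theorems.SOSTauSOSTauStubGaussPairGen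
import Summits.ValiantsHypothesis.ValiantsHypothesis.Theorems.SOSTauSOSTauStubRobustGen
import Summits.ValiantsHypothesis.ValiantsHypothesis.Theorems.SOSTauSOSTauStubPosOfRobustShallowGen

/-!
# Line `Sketch` (idea `sparse-spijker-shallow-core`) — crux `SOSTau.SOSTau` (stmt-ValiantsHypothesis-18748): LEAD SKELETON

Lead prover prover-line-stmt-ValiantsHypothesis-18748-0, 2026-08-17.

The idea (planner-cruxidea-…-18748-2-0, card `Cruxes/SOSTau/Ideas/sparse-spijker-shallow-core.md`): for a real
weighted sum of sparse squares `F = Σ aᵢ gᵢ²` with majorant `M = Σ |aᵢ| gᵢ²`, the excursions of `F` between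
consecutive positive zeros split into ROBUST ones (somewhere `|F| > M/2`) and SHALLOW ones (`|F| ≤ M/2` on the
whole closed interval).  Robust excursions are few, UNIFORMLY in the number of squares `s`: lift to the sparse curve
`x ↦ (√|aᵢ| gᵢ(x))ᵢ ∈ ℝˢ`; a Gaussian pair of linear sections `D_c = ⟨c, U_x⟩² − ⟨c, V_x⟩²` (`U` = positive block,
`V` = negative block) changes sign across a robust half-excursion with probability `≥ κ > 0` (Edelman–Kostlan's
Cauchy-law computation, here only as an inequality), while `D_c = (L₊ − L₋)(L₊ + L₋)` is a product of two
`T`-nomials (`T = |⋃ supp gᵢ| ≤ S`), so it has `≤ 2(S − 1)` positive zeros (sparse Descartes): `#robust ≤ (2/κ + 1)·S`.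
What is left — the SHALLOW core, stated for support-minimal representations so that `±B²` padding cannot fake
shallowness — is the open stub `stub_shallowCount`; it is implied by the crux (`shallowCount_of_crux`, proved below).

Stubs (each restated verbatim, def-free, as `theorem stub_…`).  Cycle 1 landed the η = 1/2 instances G, R, A and the glue B
(Theorems/SOSTauSOSTauStub{GaussPair,RobustOfGaussPair,PosOfRobustShallow,CruxOfPos}.lean = p159027 / p159325 / p158847 /
p158704).  Cycle 2 RESHAPE (this file): the threshold is made a PARAMETER — the robust side is asked for EVERY η ∈ (0,1)
(stubs Gλ `stub_gaussPairGen`, Rη `stub_robustGen`, glue Aη `stub_posOfRobustShallowGen`, all provable now by the cycle-1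
proofs with 3 ↦ λ = (1+η)/(1−η)), so that the open core only has to be proved for SOME threshold η of the prover's choosing
(`stub_shallowSome`: ∃ η ∈ (0,1) …) — a strictly weaker-looking open stub, still implied by the crux (`shallowSome_of_crux`).
The η = 1/2 statements of cycle 1 are kept below as documentation (`Stmt.gaussPair`, `Stmt.robustCount`, `Stmt.shallowCount`).
Registered stubs of the reshaped skeleton:
* Gλ `stub_gaussPairGen`         — Gaussian pair for every ratio λ > 1 (cycle-1 G is λ = 3): provable now.
* Rη `stub_robustGen`            — Gλ ⇒ for every η ∈ (0,1) the η-robust excursions number ≤ C_η·S: provable now.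
* Sh `stub_shallowSome`          — ∃ η ∈ (0,1): η-shallow excursions of support-minimal representations ≤ C·S (OPEN core; lead).
* Aη `stub_posOfRobustShallowGen` — Rη-statement ⇒ Sh-statement ⇒ positive distinct zeros ≤ c·S: provable now (cycle-1 A at η).
* B  `stub_cruxOfPos`            — positive count ⇒ the crux: LANDED (p158704), discharged below.

Composition (PROVED): `SOSTau_of` and `crux_of_stubs : SOSTau`; sanity (PROVED): `shallowSome_of_crux` (the open stub is a
consequence of the crux), and the cycle-1 sanity lemmas.

Disproof.lean: none published for this crux at the time of writing (`Cruxes/SOSTau/Disproof.lean` absent, payload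
path not mounted).  Landed negatives honoured: `Theorems/SOSTau/Negative/LoadBearing` — every count here is of
DISTINCT zeros (`roots.toFinset`), and `c = 0` is never claimed.
-/

set_option linter.dupNamespace false

noncomputable section

open Polynomial MeasureTheory ProbabilityTheory
open scoped BigOperators

namespace Summit.ValiantsHypothesis.ValiantsHypothesis.Cruxes.SOSTau.Sketch

/-! ## Statements (`Prop`s); the registered stubs below restate them verbatim -/

/-- **G (Gaussian pair).** For the standard Gaussian `c` on `ℝⁿ` and orthogonal `U, V` with `U ≠ 0`:
if `‖U‖ = ‖V‖` then `⟨c,U⟩² < ⟨c,V⟩²` with probability `≥ 1/2` (in fact `= 1/2`: the two functionals are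
independent `N(0, ‖U‖²)` and ties have probability `0`); if `‖U‖² ≥ 3‖V‖²` then `⟨c,V⟩² < ⟨c,U⟩²` with probability
`≥ 1/2 + κ` for an absolute `κ > 0` (`κ = P[Z₁² ≤ Z₂² < 3 Z₁²]` for independent standard normals; any explicit
positive lower bound will do, e.g. `P[Z₁ ∈ [1, 6/5]] · P[Z₂ ∈ [6/5, 17/10]]`). -/
def Stmt.gaussPair : Prop :=
  ∃ κ : ℝ, 0 < κ ∧ ∀ (n : ℕ) (U V : EuclideanSpace ℝ (Fin n)), inner ℝ U V = 0 → 0 < ‖U‖ →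
    (‖U‖ = ‖V‖ →
      (1 / 2 : ℝ) ≤ (stdGaussian (EuclideanSpace ℝ (Fin n))).real {c | inner ℝ c U ^ 2 < inner ℝ c V ^ 2}) ∧
    (3 * ‖V‖ ^ 2 ≤ ‖U‖ ^ 2 →
      1 / 2 + κ ≤ (stdGaussian (EuclideanSpace ℝ (Fin n))).real {c | inner ℝ c V ^ 2 < inner ℝ c U ^ 2})

/-- **R (robust-excursion count).** Given positive zeros `z₀ < z₁ < … < z_N` of `F = Σ aᵢgᵢ²` and a set `K` of
indices `k` for which the excursion `(z_k, z_{k+1})` is ROBUST (contains a point `t` with `M(t)/2 < |F(t)|`,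
`M = Σ|aᵢ|gᵢ²`), `|K| ≤ C · Σ|supp gᵢ|` for an absolute `C`. -/
def Stmt.robustCount : Prop :=
  ∃ C : ℕ, ∀ (s : ℕ) (a : Fin s → ℝ) (g : Fin s → ℝ[X]) (N : ℕ) (z : Fin (N + 1) → ℝ) (K : Finset (Fin N)),
    StrictMono z → 0 < z 0 →
    (∀ k, (∑ i, Polynomial.C (a i) * g i ^ 2).eval (z k) = 0) →
    (∀ k ∈ K, ∃ t : ℝ, z k.castSucc < t ∧ t < z k.succ ∧
      2⁻¹ * (∑ i, Polynomial.C (|a i|) * g i ^ 2).eval t < |(∑ i, Polynomial.C (a i) * g i ^ 2).eval t|) →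
    K.card ≤ C * ∑ i, (g i).support.card

/-- **Sh (shallow core, OPEN).** For a SUPPORT-MINIMAL representation (no representation of the same polynomial has
smaller support-sum — this excludes `±B²` padding, which makes every excursion shallow for free): given positive
zeros `z₀ < … < z_N` of `F ≠ 0` and a set `K` of indices whose excursion `[z_k, z_{k+1}]` is SHALLOW
(`|F| ≤ M/2` throughout), `|K| ≤ C · Σ|supp gᵢ|` for an absolute `C`. -/
def Stmt.shallowCount : Prop :=
  ∃ C : ℕ, ∀ (s : ℕ) (a : Fin s → ℝ) (g : Fin s → ℝ[X]),
    (∀ (s' : ℕ) (a' : Fin s' → ℝ) (g' : Fin s' → ℝ[X]),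
      (∑ i, Polynomial.C (a' i) * g' i ^ 2) = (∑ i, Polynomial.C (a i) * g i ^ 2) →
        ∑ i, (g i).support.card ≤ ∑ i, (g' i).support.card) →
    ∀ (N : ℕ) (z : Fin (N + 1) → ℝ) (K : Finset (Fin N)),
    StrictMono z → 0 < z 0 → (∑ i, Polynomial.C (a i) * g i ^ 2) ≠ 0 →
    (∀ k, (∑ i, Polynomial.C (a i) * g i ^ 2).eval (z k) = 0) →
    (∀ k ∈ K, ∀ t : ℝ, z k.castSucc ≤ t → t ≤ z k.succ →
      |(∑ i, Polynomial.C (a i) * g i ^ 2).eval t| ≤ 2⁻¹ * (∑ i, Polynomial.C (|a i|) * g i ^ 2).eval t) →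
    K.card ≤ C * ∑ i, (g i).support.card

/-- **Gλ (Gaussian pair, general ratio).** As `Stmt.gaussPair` but with the ratio `3` replaced by any `λ > 1`
(`κ = P[Z₁² ≤ Z₂² < λ Z₁²] > 0`; a box `Z₁ ∈ [1,a], Z₂ ∈ [a,b]` with `1 < a < b`, `b² < λ` gives an explicit positive lower bound,
e.g. `b = min 2 ((3+λ)/4)`, `a = (1+b)/2`). -/
def Stmt.gaussPairGen : Prop :=
  ∀ lam : ℝ, 1 < lam → ∃ κ : ℝ, 0 < κ ∧ ∀ (n : ℕ) (U V : EuclideanSpace ℝ (Fin n)), inner ℝ U V = 0 → 0 < ‖U‖ →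
    (‖U‖ = ‖V‖ →
      (1 / 2 : ℝ) ≤ (stdGaussian (EuclideanSpace ℝ (Fin n))).real {c | inner ℝ c U ^ 2 < inner ℝ c V ^ 2}) ∧
    (lam * ‖V‖ ^ 2 ≤ ‖U‖ ^ 2 →
      1 / 2 + κ ≤ (stdGaussian (EuclideanSpace ℝ (Fin n))).real {c | inner ℝ c V ^ 2 < inner ℝ c U ^ 2})

/-- **Rη (robust-excursion count at every threshold).** For every `η ∈ (0,1)` there is `C` such that, along positive zeros
`z₀ < … < z_N` of `F`, any set `K` of indices whose excursion contains a point `t` with `η·M(t) < |F(t)|` has `|K| ≤ C·S`.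
(From Gλ at `λ = (1+η)/(1−η)`, exactly as cycle 1's R from G.) -/
def Stmt.robustCountGen : Prop :=
  ∀ η : ℝ, 0 < η → η < 1 → ∃ C : ℕ, ∀ (s : ℕ) (a : Fin s → ℝ) (g : Fin s → ℝ[X]) (N : ℕ) (z : Fin (N + 1) → ℝ)
    (K : Finset (Fin N)),
    StrictMono z → 0 < z 0 →
    (∀ k, (∑ i, Polynomial.C (a i) * g i ^ 2).eval (z k) = 0) →
    (∀ k ∈ K, ∃ t : ℝ, z k.castSucc < t ∧ t < z k.succ ∧
      η * (∑ i, Polynomial.C (|a i|) * g i ^ 2).eval t < |(∑ i, Polynomial.C (a i) * g i ^ 2).eval t|) →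
    K.card ≤ C * ∑ i, (g i).support.card

/-- **Sh∃ (shallow core at SOME threshold, OPEN).** There are `η ∈ (0,1)` and `C` such that for every SUPPORT-MINIMAL
representation, along positive zeros `z₀ < … < z_N` of `F ≠ 0`, any set `K` of indices whose closed excursion is η-SHALLOW
(`|F| ≤ η·M` throughout) has `|K| ≤ C·S`.  The prover of the core chooses η (as small as convenient). -/
def Stmt.shallowCountSome : Prop :=
  ∃ η : ℝ, 0 < η ∧ η < 1 ∧ ∃ C : ℕ, ∀ (s : ℕ) (a : Fin s → ℝ) (g : Fin s → ℝ[X]),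
    (∀ (s' : ℕ) (a' : Fin s' → ℝ) (g' : Fin s' → ℝ[X]),
      (∑ i, Polynomial.C (a' i) * g' i ^ 2) = (∑ i, Polynomial.C (a i) * g i ^ 2) →
        ∑ i, (g i).support.card ≤ ∑ i, (g' i).support.card) →
    ∀ (N : ℕ) (z : Fin (N + 1) → ℝ) (K : Finset (Fin N)),
    StrictMono z → 0 < z 0 → (∑ i, Polynomial.C (a i) * g i ^ 2) ≠ 0 →
    (∀ k, (∑ i, Polynomial.C (a i) * g i ^ 2).eval (z k) = 0) →
    (∀ k ∈ K, ∀ t : ℝ, z k.castSucc ≤ t → t ≤ z k.succ →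
      |(∑ i, Polynomial.C (a i) * g i ^ 2).eval t| ≤ η * (∑ i, Polynomial.C (|a i|) * g i ^ 2).eval t) →
    K.card ≤ C * ∑ i, (g i).support.card

/-- **Positive-zero form of the crux.** -/
def Stmt.posCount : Prop :=
  ∃ c : ℕ, ∀ (s : ℕ) (a : Fin s → ℝ) (g : Fin s → ℝ[X]),
    ((∑ i, Polynomial.C (a i) * g i ^ 2).roots.toFinset.filter (fun x => 0 < x)).card ≤
      c * ∑ i, (g i).support.card

/-- The crux, by name. -/
abbrev Crux : Prop := Summit.ValiantsHypothesis.ValiantsHypothesis.Theses.SOSTau.SOSTau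

/-! ## Cycle-1 instances (η = 1/2): LANDED, discharged by the Theorems files (kept as documentation and for reuse) -/

/-- Cycle-1 G (ratio 3 = threshold η = 1/2), LANDED p159027. -/
theorem stub_gaussPair :
    ∃ κ : ℝ, 0 < κ ∧ ∀ (n : ℕ) (U V : EuclideanSpace ℝ (Fin n)), inner ℝ U V = 0 → 0 < ‖U‖ →
      (‖U‖ = ‖V‖ →
        (1 / 2 : ℝ) ≤ (stdGaussian (EuclideanSpace ℝ (Fin n))).real {c | inner ℝ c U ^ 2 < inner ℝ c V ^ 2}) ∧
      (3 * ‖V‖ ^ 2 ≤ ‖U‖ ^ 2 →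
        1 / 2 + κ ≤ (stdGaussian (EuclideanSpace ℝ (Fin n))).real {c | inner ℝ c V ^ 2 < inner ℝ c U ^ 2}) :=
  Summit.ValiantsHypothesis.ValiantsHypothesis.Theorems.SOSTauSOSTau.stub_gaussPair

/-- Cycle-1 R (η = 1/2), LANDED p159325. -/
theorem robustCount_half : Stmt.robustCount :=
  Summit.ValiantsHypothesis.ValiantsHypothesis.Theorems.SOSTauSOSTau.stub_robustOfGaussPair stub_gaussPair

/-- Cycle-1 composition at η = 1/2 (documentation): the crux from the η = 1/2 shallow core alone. -/
theorem SOSTau_of_half (hSh : Stmt.shallowCount) : Summit.ValiantsHypothesis.ValiantsHypothesis.Theses.SOSTau.SOSTau :=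
  Summit.ValiantsHypothesis.ValiantsHypothesis.Theorems.SOSTauSOSTau.stub_cruxOfPos
    (Summit.ValiantsHypothesis.ValiantsHypothesis.Theorems.SOSTauSOSTau.stub_posOfRobustShallow robustCount_half hSh)

/-! ## Registered stubs of the reshaped skeleton (Gλ p171589, Rη p171605, Aη p171546, B p158704 LANDED and discharged; Sh∃ = the only `sorry`) -/

/-- stub Gλ = `Stmt.gaussPairGen`: LANDED p171589. -/
theorem stub_gaussPairGen :
    ∀ lam : ℝ, 1 < lam → ∃ κ : ℝ, 0 < κ ∧ ∀ (n : ℕ) (U V : EuclideanSpace ℝ (Fin n)), inner ℝ U V = 0 → 0 < ‖U‖ →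
      (‖U‖ = ‖V‖ →
        (1 / 2 : ℝ) ≤ (stdGaussian (EuclideanSpace ℝ (Fin n))).real {c | inner ℝ c U ^ 2 < inner ℝ c V ^ 2}) ∧
      (lam * ‖V‖ ^ 2 ≤ ‖U‖ ^ 2 →
        1 / 2 + κ ≤ (stdGaussian (EuclideanSpace ℝ (Fin n))).real {c | inner ℝ c V ^ 2 < inner ℝ c U ^ 2}) :=
  Summit.ValiantsHypothesis.ValiantsHypothesis.Theorems.SOSTauSOSTau.stub_gaussPairGen

/-- stub Rη = `Stmt.gaussPairGen → Stmt.robustCountGen`: LANDED p171605. -/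
theorem stub_robustGen :
    (∀ lam : ℝ, 1 < lam → ∃ κ : ℝ, 0 < κ ∧ ∀ (n : ℕ) (U V : EuclideanSpace ℝ (Fin n)), inner ℝ U V = 0 → 0 < ‖U‖ →
      (‖U‖ = ‖V‖ →
        (1 / 2 : ℝ) ≤ (stdGaussian (EuclideanSpace ℝ (Fin n))).real {c | inner ℝ c U ^ 2 < inner ℝ c V ^ 2}) ∧
      (lam * ‖V‖ ^ 2 ≤ ‖U‖ ^ 2 →
        1 / 2 + κ ≤ (stdGaussian (EuclideanSpace ℝ (Fin n))).real {c | inner ℝ c V ^ 2 < inner ℝ c U ^ 2})) →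
    ∀ η : ℝ, 0 < η → η < 1 → ∃ C : ℕ, ∀ (s : ℕ) (a : Fin s → ℝ) (g : Fin s → ℝ[X]) (N : ℕ) (z : Fin (N + 1) → ℝ)
      (K : Finset (Fin N)),
      StrictMono z → 0 < z 0 →
      (∀ k, (∑ i, Polynomial.C (a i) * g i ^ 2).eval (z k) = 0) →
      (∀ k ∈ K, ∃ t : ℝ, z k.castSucc < t ∧ t < z k.succ ∧
        η * (∑ i, Polynomial.C (|a i|) * g i ^ 2).eval t < |(∑ i, Polynomial.C (a i) * g i ^ 2).eval t|) →
      K.card ≤ C * ∑ i, (g i).support.card :=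
  Summit.ValiantsHypothesis.ValiantsHypothesis.Theorems.SOSTauSOSTau.stub_robustGen

/-- stub Sh∃ = `Stmt.shallowCountSome` (OPEN core; held by the lead). -/
theorem stub_shallowSome :
    ∃ η : ℝ, 0 < η ∧ η < 1 ∧ ∃ C : ℕ, ∀ (s : ℕ) (a : Fin s → ℝ) (g : Fin s → ℝ[X]),
      (∀ (s' : ℕ) (a' : Fin s' → ℝ) (g' : Fin s' → ℝ[X]),
        (∑ i, Polynomial.C (a' i) * g' i ^ 2) = (∑ i, Polynomial.C (a i) * g i ^ 2) →
          ∑ i, (g i).support.card ≤ ∑ i, (g' i).support.card) →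
      ∀ (N : ℕ) (z : Fin (N + 1) → ℝ) (K : Finset (Fin N)),
      StrictMono z → 0 < z 0 → (∑ i, Polynomial.C (a i) * g i ^ 2) ≠ 0 →
      (∀ k, (∑ i, Polynomial.C (a i) * g i ^ 2).eval (z k) = 0) →
      (∀ k ∈ K, ∀ t : ℝ, z k.castSucc ≤ t → t ≤ z k.succ →
        |(∑ i, Polynomial.C (a i) * g i ^ 2).eval t| ≤ η * (∑ i, Polynomial.C (|a i|) * g i ^ 2).eval t) →
      K.card ≤ C * ∑ i, (g i).support.card := by
  sorry

/-- stub Aη = `Stmt.robustCountGen → Stmt.shallowCountSome → Stmt.posCount`: LANDED p171546. -/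
theorem stub_posOfRobustShallowGen :
    (∀ η : ℝ, 0 < η → η < 1 → ∃ C : ℕ, ∀ (s : ℕ) (a : Fin s → ℝ) (g : Fin s → ℝ[X]) (N : ℕ) (z : Fin (N + 1) → ℝ)
      (K : Finset (Fin N)),
      StrictMono z → 0 < z 0 →
      (∀ k, (∑ i, Polynomial.C (a i) * g i ^ 2).eval (z k) = 0) →
      (∀ k ∈ K, ∃ t : ℝ, z k.castSucc < t ∧ t < z k.succ ∧
        η * (∑ i, Polynomial.C (|a i|) * g i ^ 2).eval t < |(∑ i, Polynomial.C (a i) * g i ^ 2).eval t|) →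
      K.card ≤ C * ∑ i, (g i).support.card) →
    (∃ η : ℝ, 0 < η ∧ η < 1 ∧ ∃ C : ℕ, ∀ (s : ℕ) (a : Fin s → ℝ) (g : Fin s → ℝ[X]),
      (∀ (s' : ℕ) (a' : Fin s' → ℝ) (g' : Fin s' → ℝ[X]),
        (∑ i, Polynomial.C (a' i) * g' i ^ 2) = (∑ i, Polynomial.C (a i) * g i ^ 2) →
          ∑ i, (g i).support.card ≤ ∑ i, (g' i).support.card) →
      ∀ (N : ℕ) (z : Fin (N + 1) → ℝ) (K : Finset (Fin N)),
      StrictMono z → 0 < z 0 → (∑ i, Polynomial.C (a i) * g i ^ 2) ≠ 0 →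
      (∀ k, (∑ i, Polynomial.C (a i) * g i ^ 2).eval (z k) = 0) →
      (∀ k ∈ K, ∀ t : ℝ, z k.castSucc ≤ t → t ≤ z k.succ →
        |(∑ i, Polynomial.C (a i) * g i ^ 2).eval t| ≤ η * (∑ i, Polynomial.C (|a i|) * g i ^ 2).eval t) →
      K.card ≤ C * ∑ i, (g i).support.card) →
    ∃ c : ℕ, ∀ (s : ℕ) (a : Fin s → ℝ) (g : Fin s → ℝ[X]),
      ((∑ i, Polynomial.C (a i) * g i ^ 2).roots.toFinset.filter (fun x => 0 < x)).card ≤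
        c * ∑ i, (g i).support.card :=
  Summit.ValiantsHypothesis.ValiantsHypothesis.Theorems.SOSTauSOSTau.stub_posOfRobustShallowGen

/-- stub B = `Stmt.posCount → Crux`: LANDED p158704. -/
theorem stub_cruxOfPos :
    (∃ c : ℕ, ∀ (s : ℕ) (a : Fin s → ℝ) (g : Fin s → ℝ[X]),
      ((∑ i, Polynomial.C (a i) * g i ^ 2).roots.toFinset.filter (fun x => 0 < x)).card ≤
        c * ∑ i, (g i).support.card) →
    Summit.ValiantsHypothesis.ValiantsHypothesis.Theses.SOSTau.SOSTau :=
  Summit.ValiantsHypothesis.ValiantsHypothesis.Theorems.SOSTauSOSTau.stub_cruxOfPos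

/-! ## Composition (PROVED) -/

/-- **The line closes the crux modulo its stubs**: Gλ, (Gλ → Rη), Sh∃, Aη = (Rη → Sh∃ → Pos), B = (Pos → Crux). -/
theorem SOSTau_of (hG : Stmt.gaussPairGen) (hR : Stmt.gaussPairGen → Stmt.robustCountGen) (hSh : Stmt.shallowCountSome)
    (hA : Stmt.robustCountGen → Stmt.shallowCountSome → Stmt.posCount) (hB : Stmt.posCount → Crux) :
    Summit.ValiantsHypothesis.ValiantsHypothesis.Theses.SOSTau.SOSTau :=
  hB (hA (hR hG) hSh)

/-- The crux BY NAME from the registered stubs (B already landed). -/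
theorem crux_of_stubs : Summit.ValiantsHypothesis.ValiantsHypothesis.Theses.SOSTau.SOSTau :=
  SOSTau_of stub_gaussPairGen stub_robustGen stub_shallowSome stub_posOfRobustShallowGen stub_cruxOfPos

/-! ## Sanity (PROVED): both counting stubs are consequences of the crux -/

/-- Along positive zeros `z₀ < … < z_N` of a nonzero `F`, any index set `K ⊆ Fin N` has `|K| ≤ N < #roots(F)`. -/
theorem card_le_card_roots {F : ℝ[X]} (hF : F ≠ 0) {N : ℕ} (z : Fin (N + 1) → ℝ) (hz : StrictMono z)
    (hroot : ∀ k, F.eval (z k) = 0) (K : Finset (Fin N)) : K.card + 1 ≤ F.roots.toFinset.card := by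
  classical
  have himg : (Finset.univ.image z).card = N + 1 := by
    rw [Finset.card_image_of_injective _ hz.injective, Finset.card_univ, Fintype.card_fin]
  have hsub : Finset.univ.image z ⊆ F.roots.toFinset := by
    intro x hx
    obtain ⟨k, -, rfl⟩ := Finset.mem_image.mp hx
    rw [Multiset.mem_toFinset, Polynomial.mem_roots hF]
    exact hroot k
  have h1 : N + 1 ≤ F.roots.toFinset.card := himg ▸ Finset.card_le_card hsub
  have h2 : K.card ≤ N := by simpa using Finset.card_le_univ K
  omega

/-- The crux implies the shallow stub (so `stub_shallowCount` is not false unless the crux is). -/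
theorem shallowCount_of_crux (h : Crux) : Stmt.shallowCount := by
  obtain ⟨c, hc⟩ := h
  refine ⟨c, fun s a g _ N z K hz _ hF hroot _ => ?_⟩
  have := card_le_card_roots hF z hz hroot K
  have := hc s a g
  omega

/-- The crux implies the ∃-threshold shallow stub (take η = 1/2). -/
theorem shallowSome_of_crux (h : Crux) : Stmt.shallowCountSome := by
  obtain ⟨c, hc⟩ := h
  refine ⟨1 / 2, by norm_num, by norm_num, c, fun s a g _ N z K hz _ hF hroot _ => ?_⟩
  have := card_le_card_roots hF z hz hroot K
  have := hc s a g
  omega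

/-- The crux implies the robust stub. -/
theorem robustCount_of_crux (h : Crux) : Stmt.robustCount := by
  obtain ⟨c, hc⟩ := h
  refine ⟨c, fun s a g N z K hz _ hroot hK => ?_⟩
  by_cases hF : (∑ i, Polynomial.C (a i) * g i ^ 2) = 0
  · have hKe : K = ∅ := by
      refine Finset.eq_empty_of_forall_notMem fun k hk => ?_
      obtain ⟨t, -, -, ht⟩ := hK k hk
      rw [hF] at ht
      have h0 : (0 : ℝ) ≤ 2⁻¹ * (∑ i, Polynomial.C (|a i|) * g i ^ 2).eval t := by
        rw [Polynomial.eval_finsetSum]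
        refine mul_nonneg (by norm_num) (Finset.sum_nonneg fun i _ => ?_)
        rw [Polynomial.eval_mul, Polynomial.eval_C, Polynomial.eval_pow]
        positivity
      simp at ht
      linarith
    simp [hKe]
  · have := card_le_card_roots hF z hz hroot K
    have := hc s a g
    omega

end Summit.ValiantsHypothesis.ValiantsHypothesis.Cruxes.SOSTau.Sketch
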